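import Mathlib
import Literature.Geometry.Lorentzian.KerrConvergence
import Literature.Geometry.Lorentzian.KerrSchild
import Summits.FinalStateConjecture.FinalStateConjecture.Theorems.StarvedNecksGapDecaySufficesStubCollarLateFlat
import Summits.FinalStateConjecture.FinalStateConjecture.Theorems.NecksCertify.Negative.SeamedOneAtlasDeviation
import Summits.FinalStateConjecture.FinalStateConjecture.Theorems.StarvedNecksGapDecaySufficesStubAnchoredEntry
import Summits.FinalStateConjecture.FinalStateConjecture.Theorems.StarvedNecksGapDecaySufficesStubAnchoredRays
--   (the def-free bricks LANDED: p143739 `…StubAnchoredEntry.lean`, p144058 `…StubAnchoredRays.lean`)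

/-!
# Stub `stub_anchoredLocation` (S4 v2 of line `Sketch`, crux `GapDecaySuffices`) — wave-2 worker report

Nothing closes the registered stub `theorem stub_anchoredLocation : AnchoredLocation`; this file
KERNEL-CHECKS the reduction of S4 to ONE remaining statement, `SeededLocation` (below), on top of the
landed brick `Location.stub_collarLateFlat`-style kinematics (cone separation p106992, clock bound),
the entry bricks of `StubAnchoredEntry.lean` (`flat_entry_gapTube`: located + seeded + connected ⟹
entered, by clopen continuation over G1 / G5) and the constant-lab-time inward rays
`exists_ray_constLabTime` of `StubAnchoredRays.lean`:

  `anchoredLocation_of_seededLocation : SeededLocation → AnchoredLocation`.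

## What `SeededLocation` isolates (the analytic residue of S4, in the crux's own terms)

For the data of `AnchoredLocation` (honest radius-anchored input, hole `i`, kinematic majorant `Bk`
chosen by the statement, concave sublinear `ρ'` dominating it, a gap certificate G0–G5 of hole `i`
above `3ρ' + 2`) there are a flat time `T`, an ADMISSIBLE closed gap tube `{τ' ≤ tᵢ, rᵢ ≤ ϱ(tᵢ)}`
(`τ₁ < τ'`, `ϱ` continuous, strictly sub-wall), a SEED RADIUS profile `rs` with
`R₀ ≤ rs(s)`, `ρᵢ(s) < rs(s) < 1.1ρ'(s)` for `s ≥ T`, and `κ → 0`, such that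
* (seed spheres) every flat-domain point `z` with `z⁰ ≥ T` and `rᵢ z = rs(z⁰)` has `Φ z` in the
  gap-chart image of the OPEN tube `{τ' < tᵢ, rᵢ < ϱ(tᵢ)}` — this is `TubeAnchoredR` + G2 transported
  through the input hole chart's honest band `[R₁ + 1, 9ρᵢ + 3R₀]` (entry brick `hole_entry_gapTube`
  + `Literature.Uncategorized.BandAnchoredPaths` + a COARSE (δ = 1/10, `Hf`(3)) one-sided interval
  comparison `Ψg` vs `Ψᵢ`; needed because `9ρᵢ + 3R₀ ≤ R₁ + 1` may fail) + lateness of the anchored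
  preimages (global hyperbolicity);
* (no rim contact on the band) a gap-tube point `x` of the CLOSED tube with `Ψg x = Φ z`, `z` a
  flat-domain point with `z⁰ ≥ T`, `rs(z⁰) ≤ rᵢ z ≤ 2.9ρ'(z⁰)`, lies in the OPEN tube — coarse location;
* (location on the collar) for collar points `1.1ρ'(z⁰) ≤ rᵢ z ≤ 2.9ρ'(z⁰)` the open-tube preimage
  has hole clock and radius within `κ(tᵢ z)ρ'(z⁰)` of those of `z` — the fine (δ → 0) zeroth-order
  rigidity: the lead's `QuantAlexandrovZeeman` on balls of radius `~ρ'` + a two-sided interval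
  comparison for `k = Ψg⁻¹ ∘ Φ` (G3 + flat certificate) + pinning of the relative boost by the
  time-averaged anchoring.

## The reduction (this file, sorry-free)

Given a collar point `y` (`τ₂ < tᵢ y`, `1.1ρ'(y⁰) ≤ rᵢ y ≤ 2.9ρ'(y⁰)`): the clock bound
`stub_flatTimeGe` and monotonicity of `ρ'` make its flat time `s = y⁰` as late as required; the
boosted image of the rest-frame path `σ ↦ (τ + (1 − σ)ℓ/γ, σξ)` is a preconnected coordinate set
through `y` of CONSTANT flat time `s` on which `rᵢ` decreases monotonically to the seed radius
`rs(s)` (intermediate value theorem, star-shapedness of the Kerr–Schild balls); all its points are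
late-flat (`ρᵢ(s) < rs(s)`, cone separation for the other holes since `rᵢ ≤ 2.9ρ'(s) ≤ c·s`); the
entry brick then puts `Φ y` into the open gap tube, strictly below the wall by admissibility, and the
location clause finishes.  The kinematic majorant handed to `AnchoredLocation` is
`max |Bk| (ρᵢ + 1)` (sublinear), so that `ρᵢ + 1 ≤ 1.1ρ'` eventually and `Bk/ρ' → 0` both follow
from the domination hypothesis.

Potential statement issue for the lead (not a counterexample): `TubeAnchoredR`'s window
`[3ρᵢ + 2R₀, 4ρᵢ + 2R₀]` is EMPTY at flat times with `ρᵢ(s) < 0` (Kerr–Schild radii are `≥ 0`), so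
for inputs with eventually negative excision radius at hole `i` the anchoring antecedent is vacuous and
no seed exists from the typed clauses; `SeededLocation` makes the needed positivity explicit
(`ρᵢ(s) < rs(s)`, `R₀ ≤ rs(s)`).  Suggest `max (ρᵢ) 0` in the window of `TubeAnchoredR` (or
`0 ≤ ρᵢ` in `HonestCore`) if the lead agrees.
-/

noncomputable section

open scoped Manifold ContDiff Topology ENNReal
open Filter Set Topology Literature.Geometry.Lorentzian

namespace Summit.FinalStateConjecture.FinalStateConjecture.Theorems.GapDecaySuffices.Location

set_option linter.dupNamespace false

open Summit.FinalStateConjecture.FinalStateConjecture.Theorems.NecksCertifyTwoCap.Cones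
  (stub_coneSeparation)
open Summit.FinalStateConjecture.FinalStateConjecture.Theorems.NecksCertify.Negative (rPlus_le_two_mul)

/-! ## The statement bundles of the skeleton (verbatim copies; a work file cannot import `Cruxes`) -/

namespace AnchoredV2

/-- `HonestCore` = the crux's `Hc` (verbatim copy of the skeleton's). -/
def HonestCore (𝓢 : Spacetime.{0} 4) (O : Set 𝓢.carrier) (k : ℕ) (d : FinalStateDecomposition 𝓢 O k)
    (R₀ : ℝ) : Prop :=
  let B := d.background; let t := fun i ↦ (B i).time; let r := fun i ↦ (B i).radius; let Ψ := d.chart;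
  (∀ i, Kerr.IsSubextremal (d.mass i) (d.spin i) ∧ 100 * d.mass i ≤ R₀ ∧ 0 < ((d.motion i).1 : E4 ≃L[ℝ] E4) (E4.basisVector 0) 0) ∧
    (∀ i (ϱ τ₂ : ℝ), R₀ ≤ ϱ → d.τ₀ < τ₂ → Ψ i '' {x | d.τ₀ < t i x.1 ∧ t i x.1 < τ₂ ∧ r i x.1 < ϱ} ⊆ 𝓢.metric.causalPast 𝓢.timeOrientation (Ψ i '' (B i).truncTimeSlab ϱ τ₂)) ∧
    (∀ i (τ' : ℝ) (ϱ : ℝ → ℝ), Continuous ϱ → d.τ₀ < τ' → let A := Ψ i '' {x | τ' ≤ t i x.1 ∧ r i x.1 ≤ ϱ (t i x.1)}; closure A ∩ O ⊆ A) ∧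
    (∀ y : d.flatDomain, d.τ₀ < y.1 0 → 𝓢.timeOrientation.IsFutureDirected (mfderiv 𝓘(ℝ, E4) (𝓡 4) d.flatChart y (E4.basisVector 0)))

/-- `HonestFar` = the crux's `Hf` (verbatim copy of the skeleton's). -/
def HonestFar (𝓢 : Spacetime.{0} 4) (O : Set 𝓢.carrier) (k : ℕ) (d : FinalStateDecomposition 𝓢 O k)
    (R₀ : ℝ) : Prop :=
  let B := d.background; let t := fun i ↦ (B i).time; let r := fun i ↦ (B i).radius; let Φ := d.flatChart;
  (∀ τ₂ : ℝ, d.τ₀ < τ₂ → Φ '' {y | d.τ₀ < y.1 0 ∧ y.1 0 < τ₂} ⊆ 𝓢.metric.causalPast 𝓢.timeOrientation (Φ '' (Minkowski.backgroundOn d.flatDomain).timeSlab τ₂)) ∧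
    (∀ τ' : ℝ, d.τ₀ < τ' → closure (Φ '' {y | τ' ≤ y.1 0 ∧ ∀ i, d.excision i (y.1 0) + 1 ≤ r i y.1}) ⊆ Φ '' {y | τ' ≤ y.1 0}) ∧
    (∀ i, ∃ T : ℝ, supCkENorm (Subtype.val '' {x : (B i).domain | T ≤ t i x.1 ∧ R₀ ≤ r i x.1 ∧ ∀ j, j ≠ i → r i x.1 ≤ r j x.1}) 0 (𝓢.deviationExtend (B i) (d.chart i)) ≤ ENNReal.ofReal (1 / (10 * ‖(((d.motion i).1 : E4 ≃L[ℝ] E4) : E4 →L[ℝ] E4)‖ ^ 2)))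

/-- Pairwise distinct asymptotic four-velocities (verbatim copy of the skeleton's). -/
def DistinctVelocities (𝓢 : Spacetime.{0} 4) (O : Set 𝓢.carrier) (k : ℕ)
    (d : FinalStateDecomposition 𝓢 O k) : Prop :=
  ∀ i j : Fin d.N, i ≠ j →
    ((d.motion i).1 : E4 ≃L[ℝ] E4) (E4.basisVector 0) ≠ ((d.motion j).1 : E4 ≃L[ℝ] E4) (E4.basisVector 0)

/-- `TubeAnchoredR` (verbatim copy of the skeleton's). -/
def TubeAnchoredR {𝓢 : Spacetime.{0} 4} {O : Set 𝓢.carrier} {k : ℕ}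
    (d : FinalStateDecomposition 𝓢 O k) (R₀ : ℝ) : Prop :=
  ∀ i, ∃ T : ℝ, ∀ y : d.flatDomain, T ≤ y.1 0 →
    3 * d.excision i (y.1 0) + 2 * R₀ ≤ (d.background i).radius y.1 →
    (d.background i).radius y.1 ≤ 4 * d.excision i (y.1 0) + 2 * R₀ →
      ∃ x : (d.background i).domain, d.chart i x = d.flatChart y ∧
        d.τ₀ < (d.background i).time x.1 ∧ R₀ ≤ (d.background i).radius x.1 ∧
        (d.background i).radius x.1 ≤ 9 * d.excision i (y.1 0) + 3 * R₀ ∧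
        ∀ j, j ≠ i → (d.background i).radius x.1 ≤ (d.background j).radius x.1

/-- `AnchoredLocation` (S4 v2; verbatim copy of the skeleton's registered statement). -/
def AnchoredLocation : Prop :=
  ∀ (X : Type) [TopologicalSpace X] [ChartedSpace E3 X] [IsManifold (𝓡 3) ∞ X] [ConnectedSpace X]
    (D : InitialDataSet (𝓡 3) X), D ∈ admissibleVacuumData X →
    ∀ 𝒟 : VacuumCauchyDevelopment D, 𝒟.IsMaximal →
    ∀ (O : Set 𝒟.carrier) (d : FinalStateDecomposition 𝒟.toSpacetime O 4) (R₀ : ℝ),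
      O = exteriorOf 𝒟.toCauchyDevelopment d.charted →
      HonestCore 𝒟.toSpacetime O 4 d R₀ → HonestFar 𝒟.toSpacetime O 4 d R₀ →
      DistinctVelocities 𝒟.toSpacetime O 4 d → TubeAnchoredR d R₀ →
      ∀ i : Fin d.N, ∃ Bk : ℝ → ℝ, Tendsto (fun s ↦ Bk s / s) atTop (𝓝 0) ∧
      ∀ (ρ' : ℝ → ℝ), Monotone ρ' → Continuous ρ' → ConcaveOn ℝ (Set.Ici 0) ρ' →
        Tendsto (fun s ↦ ρ' s / s) atTop (𝓝 0) →
        Tendsto (fun s ↦ Bk s / ρ' s) atTop (𝓝 0) → (∀ s, 1 ≤ ρ' s) →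
      ∀ (R₁ τ₁ : ℝ) (W : ℝ → ℝ) (Ψg : (d.background i).domain → 𝒟.carrier),
        let B := d.background i; let t := B.time; let r := B.radius;
        R₀ ≤ R₁ → d.τ₀ ≤ τ₁ → Continuous W → (∀ s, τ₁ ≤ s → 3 * ρ' s + 2 ≤ W s) →
        (let U : Set B.domain := {x | τ₁ < t x.1 ∧ r x.1 < W (x.1 0) + 1};
          ContMDiffOn 𝓘(ℝ, E4) (𝓡 4) ∞ Ψg U ∧ Topology.IsOpenEmbedding (U.restrict Ψg) ∧
            Ψg '' U ⊆ d.charted) →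
        (∀ x : B.domain, r x.1 ≤ R₁ + 1 → Ψg x = d.chart i x) →
        Tendsto (fun τ ↦ supCkENorm (Subtype.val '' {x : B.domain | t x.1 = τ ∧ r x.1 ≤ W (x.1 0)}) 2
          (𝒟.toSpacetime.deviationExtend B Ψg)) atTop (𝓝 0) →
        (∀ x : B.domain, τ₁ ≤ t x.1 → R₁ ≤ r x.1 → r x.1 ≤ W (x.1 0) →
          𝒟.toSpacetime.timeOrientation.IsFutureDirected
            (mfderiv 𝓘(ℝ, E4) (𝓡 4) Ψg x (((d.motion i).1 : E4 ≃L[ℝ] E4) (E4.basisVector 0)))) →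
        (∀ (τ' : ℝ) (ϱ : ℝ → ℝ), Continuous ϱ → τ₁ < τ' →
          (∀ x : B.domain, τ' ≤ t x.1 → r x.1 ≤ ϱ (t x.1) → r x.1 ≤ W (x.1 0)) →
          closure (Ψg '' {x | τ' ≤ t x.1 ∧ r x.1 ≤ ϱ (t x.1)}) ∩ O ⊆
            Ψg '' {x | τ' ≤ t x.1 ∧ r x.1 ≤ ϱ (t x.1)}) →
        ∃ (τ₂ : ℝ) (κ : ℝ → ℝ), τ₁ ≤ τ₂ ∧ Tendsto κ atTop (𝓝 0) ∧
          ∀ (y : E4) (hy : y ∈ B.domain), τ₂ < t y → 11 / 10 * ρ' (y 0) ≤ r y →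
            r y ≤ 29 / 10 * ρ' (y 0) →
            ∃ hy' : y ∈ d.flatDomain, d.τ₀ < y 0 ∧
              (∀ j, d.excision j (y 0) + 1 ≤ (d.background j).radius y) ∧
              ∃ x : B.domain, τ₁ < t x.1 ∧ r x.1 < W (x.1 0) ∧ Ψg x = d.flatChart ⟨y, hy'⟩ ∧
                |t x.1 - t y| ≤ κ (t y) * ρ' (y 0) ∧ |r x.1 - r y| ≤ κ (t y) * ρ' (y 0)

/-- **`SeededLocation` — the isolated remaining input of S4** (same antecedents as
`AnchoredLocation`, verbatim, up to and including G5).  CONCLUSION: a flat time `T`, an admissible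
closed gap tube `{τ' ≤ tᵢ, rᵢ ≤ ϱ(tᵢ)}` (`τ₁ < τ'`, `ϱ` continuous, `rᵢ ≤ ϱ(tᵢ) ⟹ rᵢ < W(x⁰)`), a seed
radius profile `rs` (`R₀ ≤ rs`, `ρᵢ < rs < 1.1ρ'` after `T`) and `κ → 0` with: (seed spheres) flat
points `z`, `z⁰ ≥ T`, `rᵢ z = rs(z⁰)`, have `Φ z` in the `Ψg`-image of the open tube; (no rim contact)
closed-tube preimages of `Φ z`, `z` flat with `z⁰ ≥ T`, `rs(z⁰) ≤ rᵢ z ≤ 2.9ρ'(z⁰)`, lie in the open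
tube; (location) open-tube preimages of collar points `1.1ρ'(z⁰) ≤ rᵢ z ≤ 2.9ρ'(z⁰)`, `z⁰ ≥ T`, have
hole clock and radius within `κ(tᵢ z)·ρ'(z⁰)` of those of `z`. -/
def SeededLocation : Prop :=
  ∀ (X : Type) [TopologicalSpace X] [ChartedSpace E3 X] [IsManifold (𝓡 3) ∞ X] [ConnectedSpace X]
    (D : InitialDataSet (𝓡 3) X), D ∈ admissibleVacuumData X →
    ∀ 𝒟 : VacuumCauchyDevelopment D, 𝒟.IsMaximal →
    ∀ (O : Set 𝒟.carrier) (d : FinalStateDecomposition 𝒟.toSpacetime O 4) (R₀ : ℝ),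
      O = exteriorOf 𝒟.toCauchyDevelopment d.charted →
      HonestCore 𝒟.toSpacetime O 4 d R₀ → HonestFar 𝒟.toSpacetime O 4 d R₀ →
      DistinctVelocities 𝒟.toSpacetime O 4 d → TubeAnchoredR d R₀ →
      ∀ i : Fin d.N, ∃ Bk : ℝ → ℝ, Tendsto (fun s ↦ Bk s / s) atTop (𝓝 0) ∧
      ∀ (ρ' : ℝ → ℝ), Monotone ρ' → Continuous ρ' → ConcaveOn ℝ (Set.Ici 0) ρ' →
        Tendsto (fun s ↦ ρ' s / s) atTop (𝓝 0) →
        Tendsto (fun s ↦ Bk s / ρ' s) atTop (𝓝 0) → (∀ s, 1 ≤ ρ' s) →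
      ∀ (R₁ τ₁ : ℝ) (W : ℝ → ℝ) (Ψg : (d.background i).domain → 𝒟.carrier),
        let B := d.background i; let t := B.time; let r := B.radius;
        R₀ ≤ R₁ → d.τ₀ ≤ τ₁ → Continuous W → (∀ s, τ₁ ≤ s → 3 * ρ' s + 2 ≤ W s) →
        (let U : Set B.domain := {x | τ₁ < t x.1 ∧ r x.1 < W (x.1 0) + 1};
          ContMDiffOn 𝓘(ℝ, E4) (𝓡 4) ∞ Ψg U ∧ Topology.IsOpenEmbedding (U.restrict Ψg) ∧
            Ψg '' U ⊆ d.charted) →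
        (∀ x : B.domain, r x.1 ≤ R₁ + 1 → Ψg x = d.chart i x) →
        Tendsto (fun τ ↦ supCkENorm (Subtype.val '' {x : B.domain | t x.1 = τ ∧ r x.1 ≤ W (x.1 0)}) 2
          (𝒟.toSpacetime.deviationExtend B Ψg)) atTop (𝓝 0) →
        (∀ x : B.domain, τ₁ ≤ t x.1 → R₁ ≤ r x.1 → r x.1 ≤ W (x.1 0) →
          𝒟.toSpacetime.timeOrientation.IsFutureDirected
            (mfderiv 𝓘(ℝ, E4) (𝓡 4) Ψg x (((d.motion i).1 : E4 ≃L[ℝ] E4) (E4.basisVector 0)))) →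
        (∀ (τ' : ℝ) (ϱ : ℝ → ℝ), Continuous ϱ → τ₁ < τ' →
          (∀ x : B.domain, τ' ≤ t x.1 → r x.1 ≤ ϱ (t x.1) → r x.1 ≤ W (x.1 0)) →
          closure (Ψg '' {x | τ' ≤ t x.1 ∧ r x.1 ≤ ϱ (t x.1)}) ∩ O ⊆
            Ψg '' {x | τ' ≤ t x.1 ∧ r x.1 ≤ ϱ (t x.1)}) →
        ∃ (T τ' : ℝ) (ϱ rs κ : ℝ → ℝ), τ₁ < τ' ∧ Continuous ϱ ∧ Tendsto κ atTop (𝓝 0) ∧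
          (∀ x : B.domain, τ' ≤ t x.1 → r x.1 ≤ ϱ (t x.1) → r x.1 < W (x.1 0)) ∧
          (∀ s, T ≤ s → R₀ ≤ rs s ∧ d.excision i s < rs s ∧ rs s < 11 / 10 * ρ' s) ∧
          (∀ (z : E4) (hz : z ∈ d.flatDomain), T ≤ z 0 → r z = rs (z 0) →
            ∃ x : B.domain, τ' < t x.1 ∧ r x.1 < ϱ (t x.1) ∧ Ψg x = d.flatChart ⟨z, hz⟩) ∧
          (∀ (z : E4) (hz : z ∈ d.flatDomain), T ≤ z 0 → rs (z 0) ≤ r z →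
            r z ≤ 29 / 10 * ρ' (z 0) →
            ∀ x : B.domain, τ' ≤ t x.1 → r x.1 ≤ ϱ (t x.1) → Ψg x = d.flatChart ⟨z, hz⟩ →
              τ' < t x.1 ∧ r x.1 < ϱ (t x.1)) ∧
          (∀ (z : E4) (hz : z ∈ d.flatDomain), T ≤ z 0 → 11 / 10 * ρ' (z 0) ≤ r z →
            r z ≤ 29 / 10 * ρ' (z 0) →
            ∀ x : B.domain, τ' < t x.1 → r x.1 < ϱ (t x.1) → Ψg x = d.flatChart ⟨z, hz⟩ →
              |t x.1 - t z| ≤ κ (t z) * ρ' (z 0) ∧ |r x.1 - r z| ≤ κ (t z) * ρ' (z 0))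

/-- **Suggested E4-level primitive for the two location clauses of `SeededLocation`** (two-metric
form, no manifold API; M-sized, Mathlib-level): the ONE-SIDED INTERVAL COMPARISON for an exact
isometry `k` between `η + h₁` on a convex coordinate region and `η + h₂` on its image, with
`‖h₁‖, ‖h₂‖ ≤ ε` and an a-priori operator bound `‖Dk‖ ≤ Γ` (the relative boost; `C = C(Γ)`): the
`k`-images of uniformly timelike pairs are timelike with `η`-interval at least `(1 − Cε)` times the
original.  Proof: `s ↦ k(P + s(Q − P))` has `(η + h₂)`-velocity of squared length
`(η + h₁)(Q − P, Q − P) ≤ (1 − 4ε)η(Q − P, Q − P) < 0`, so its `η`-velocities are timelike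
(`‖v‖ ≤ Γ‖Q − P‖` absorbs `h₂`), consistently time-oriented by continuity, and the REVERSE MINKOWSKI
inequality `N(∫v) ≥ ∫N(v)` for `N(w) = √(−η(w, w))` on the future cone (support-function form
`N(w) = inf_T (−η(T, w))` over unit future timelike `T`, reverse Cauchy–Schwarz) gives the claim with
`C = 4(1 + Γ²)`.  In S4 it is applied to `k = Ψg⁻¹ ∘ Φ` (G3 + the flat certificate give `h₂, h₁`;
the operator bound is the bootstrap assumption on the relative boost, refreshed at every scale by
the time-averaged anchoring) and, with `ε = 1/10 + 2M/R₀`, to `k = Ψg⁻¹ ∘ Ψᵢ` on the anchoring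
band (`Hf`(3)); the reverse inequality (two-sidedness, needed by `QuantAlexandrovZeeman`) is the
same statement for `k⁻¹` on the image. -/
def OneSidedIntervalComparison : Prop :=
  ∀ Γ : ℝ, 1 ≤ Γ → ∃ C ε₀ : ℝ, 0 < C ∧ 0 < ε₀ ∧
    ∀ (ε : ℝ) (D : Set E4) (k : E4 → E4) (h₁ h₂ : E4 → E4 →L[ℝ] E4 →L[ℝ] ℝ),
      0 ≤ ε → ε ≤ ε₀ → Convex ℝ D → IsOpen D → DifferentiableOn ℝ k D →
      (∀ x ∈ D, ‖fderiv ℝ k x‖ ≤ Γ) → (∀ x ∈ D, ‖h₁ x‖ ≤ ε) → (∀ x ∈ D, ‖h₂ (k x)‖ ≤ ε) →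
      (∀ x ∈ D, ∀ v w : E4,
        (Minkowski.bilin + h₂ (k x)) (fderiv ℝ k x v) (fderiv ℝ k x w) =
          (Minkowski.bilin + h₁ x) v w) →
      ∀ P ∈ D, ∀ Q ∈ D, Minkowski.bilin (Q - P) (Q - P) ≤ -(1 / 4) * ‖Q - P‖ ^ 2 →
        (1 - C * ε) * (-Minkowski.bilin (Q - P) (Q - P)) ≤
          -Minkowski.bilin (k Q - k P) (k Q - k P)

/-! ## The reduction -/

set_option maxHeartbeats 800000 in
/-- **S4 from `SeededLocation`** (kernel-checked reduction): late-flatness of the collar and of the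
constant-lab-time rays (clock bound `stub_flatTimeGe`, cone separation p106992, sublinearity), entry
of every collar point by clopen continuation along its ray (`flat_entry_gapTube`), seeded on the seed
sphere and located by the hypothesis. -/
theorem anchoredLocation_of_seededLocation (hX : SeededLocation) : AnchoredLocation := by
  intro X _ _ _ _ D hD 𝒟 h𝒟 O d R₀ hO hc hf hdv hanch i
  obtain ⟨Bk, hBk, hX'⟩ := hX X D hD 𝒟 h𝒟 O d R₀ hO hc hf hdv hanch i
  refine ⟨fun s ↦ max |Bk s| (d.excision i s + 1),
    tendsto_max_abs_add_one_div hBk (d.tendsto_excision_div i), ?_⟩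
  intro ρ' hmono hcont hconc hsub hdom hone R₁ τ₁ W Ψg B t r hR hτ hW hwall hG1 hG2 hG3 hG4 hG5
  -- positivity of `ρ'`
  have hρpos : ∀ s, 0 < ρ' s := fun s ↦ lt_of_lt_of_le one_pos (hone s)
  -- the two consequences of the domination hypothesis
  have hdomBk : Tendsto (fun s ↦ Bk s / ρ' s) atTop (𝓝 0) := by
    refine squeeze_zero_norm' ?_ hdom
    filter_upwards with s
    rw [Real.norm_eq_abs, abs_div, abs_of_pos (hρpos s)]
    exact div_le_div_of_nonneg_right (le_max_left _ _) (hρpos s).le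
  have hexc : ∀ᶠ s in atTop, d.excision i s + 1 ≤ 11 / 10 * ρ' s := by
    filter_upwards [hdom.eventually (gt_mem_nhds one_pos)] with s hs
    rw [div_lt_one (hρpos s)] at hs
    linarith [le_max_right |Bk s| (d.excision i s + 1), hρpos s]
  -- the isolated input
  obtain ⟨T, τ', ϱ, rs, κ, hτ', hϱ, hκ, hadm, hrs, hseed, hrim, hloc⟩ :=
    hX' ρ' hmono hcont hconc hsub hdomBk hone R₁ τ₁ W Ψg hR hτ hW hwall hG1 hG2 hG3 hG4 hG5
  -- orthochronicity, distinct velocities, cone separation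
  have horth : ∀ j, 0 < ((d.motion j).1 : E4 ≃L[ℝ] E4) (E4.basisVector 0) 0 := fun j ↦ (hc.1 j).2.2
  obtain ⟨c, hc0, τc, hcone⟩ := stub_coneSeparation _ O 4 d horth hdv
  -- eventual facts in the flat time `s`
  have hE2 : ∀ᶠ s in atTop, ∀ j, d.excision j s + 1 ≤ c * s := by
    refine Filter.eventually_all.2 fun j ↦ ?_
    have h1 : ∀ᶠ s in atTop, d.excision j s / s < c / 2 :=
      (d.tendsto_excision_div j).eventually (gt_mem_nhds (by positivity))
    filter_upwards [h1, eventually_gt_atTop (0 : ℝ), eventually_ge_atTop (2 / c)] with s hs hs0 hs2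
    rw [div_lt_iff₀ hs0] at hs
    rw [div_le_iff₀' hc0] at hs2
    linarith
  have hE3 : ∀ᶠ s in atTop, 29 / 10 * ρ' s ≤ c * s := by
    have h1 : ∀ᶠ s in atTop, ρ' s / s < c / 3 := hsub.eventually (gt_mem_nhds (by positivity))
    filter_upwards [h1, eventually_gt_atTop (0 : ℝ)] with s hs hs0
    rw [div_lt_iff₀ hs0] at hs
    linarith [hρpos s]
  obtain ⟨T₀, hT₀⟩ := Filter.eventually_atTop.1
    (hexc.and (hE2.and (hE3.and ((eventually_ge_atTop τc).and
      ((eventually_gt_atTop d.τ₀).and (eventually_ge_atTop T))))))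
  -- the clock constants of hole `i` and the choice of `τ₂`
  obtain ⟨γ, hγ⟩ : ∃ γ : ℝ, γ = (((d.motion i).1 : E4 ≃L[ℝ] E4) (E4.basisVector 0)) 0 := ⟨_, rfl⟩
  have hγ0 : 0 < γ := hγ ▸ horth i
  obtain ⟨S₀, hS₀⟩ : ∃ S₀ : ℝ, S₀ = Real.sqrt (γ ^ 2 - 1) * (29 / 10 * ρ' T₀ + |d.spin i|) :=
    ⟨_, rfl⟩
  refine ⟨max τ₁ ((T₀ - (d.motion i).2 0 + S₀) / γ), κ, le_max_left _ _, hκ, ?_⟩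
  intro y hyB hty hlo hhi
  -- the flat time `s = y⁰` of the collar point is late
  have hclock : (d.motion i).2 0 + γ * t y -
      Real.sqrt (γ ^ 2 - 1) * (r y + |d.spin i|) ≤ y 0 := by
    have h := stub_flatTimeGe (d.motion i).1 (d.motion i).2 (d.mass i) (d.spin i) y
    rw [← hγ] at h
    exact h
  have hT' : T₀ ≤ y 0 := by
    by_contra hlt
    rw [not_le] at hlt
    have h1 : ρ' (y 0) ≤ ρ' T₀ := hmono hlt.le
    have h2 : r y ≤ 29 / 10 * ρ' T₀ := hhi.trans (by linarith)
    have h3 : Real.sqrt (γ ^ 2 - 1) * (r y + |d.spin i|) ≤ S₀ := by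
      rw [hS₀]
      exact mul_le_mul_of_nonneg_left (by linarith) (Real.sqrt_nonneg _)
    have h4 : (T₀ - (d.motion i).2 0 + S₀) / γ < t y := lt_of_le_of_lt (le_max_right _ _) hty
    rw [div_lt_iff₀ hγ0] at h4
    linarith
  obtain ⟨hx1, hx2, hx3, hx4, hx5, hx6⟩ := hT₀ (y 0) hT'
  obtain ⟨hrsR, hrsρ, hrs11⟩ := hrs (y 0) hx6
  -- late-flatness of every point of flat time `y⁰` with radius in `[rs(y⁰), rᵢ y]`
  have hflat : ∀ z : E4, z 0 = y 0 → rs (y 0) ≤ r z → r z ≤ r y →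
      z ∈ d.flatDomain ∧ d.τ₀ < z 0 ∧
        ∀ j, j ≠ i → d.excision j (z 0) + 1 ≤ (d.background j).radius z := by
    intro z hz0 hzlo hzhi
    have hri : (d.background i).radius z ≤ c * z 0 := by
      rw [hz0]
      exact (hzhi.trans hhi).trans hx3
    have hother : ∀ j, j ≠ i → d.excision j (z 0) + 1 ≤ (d.background j).radius z := by
      intro j hij
      have h := hcone i j z (Ne.symm hij) (by rw [hz0]; exact hx4) hri
      rw [hz0] at h ⊢
      linarith [hx2 j]
    refine ⟨d.setOf_lt_excision_subset_flatDomain ⟨by rw [hz0]; exact hx5, fun j ↦ ?_⟩,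
      by rw [hz0]; exact hx5, hother⟩
    show d.excision j (z 0) < (d.background j).radius z
    rcases eq_or_ne j i with rfl | hij
    · rw [hz0]
      exact lt_of_lt_of_le hrsρ hzlo
    · linarith [hother j hij]
  -- the constant-lab-time ray from `y` down to the seed sphere
  have hmass : 0 < d.mass i := d.mass_pos i
  have hr₀ : max (Kerr.rPlus (d.mass i) (d.spin i)) 0 < rs (y 0) := by
    refine max_lt ?_ (by linarith [(hc.1 i).2.1])
    have := rPlus_le_two_mul hmass.le (d.spin i)
    linarith [(hc.1 i).2.1]
  have hr₀y : rs (y 0) ≤ r y := by linarith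
  obtain ⟨S, hSpre, hyS, hSdom, hSprop, z₀, hz₀S, hz₀r⟩ :=
    exists_ray_constLabTime (d.motion i).1 (d.motion i).2 (d.mass i) (d.spin i) (horth i) y hr₀ hr₀y
  have hSf : S ⊆ (d.flatDomain : Set E4) := fun z hz ↦
    (hflat z (hSprop z hz).1 (hSprop z hz).2.1 (hSprop z hz).2.2).1
  have hSlate : ∀ z ∈ S, d.τ₀ < z 0 := fun z hz ↦
    (hflat z (hSprop z hz).1 (hSprop z hz).2.1 (hSprop z hz).2.2).2.1
  -- entry along the ray
  have hadm' : ∀ x : B.domain, τ' ≤ t x.1 → r x.1 ≤ ϱ (t x.1) → r x.1 ≤ W (x.1 0) :=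
    fun x h1 h2 ↦ (hadm x h1 h2).le
  have hentry := flat_entry_gapTube d i hG1.2.1 (hG5 τ' ϱ hϱ hτ' hadm') hϱ hτ' hadm' hSpre hSf hSlate
    (fun z hz x hx1 hx2 hhx ↦ by
      obtain ⟨hz0, hzlo, hzhi⟩ := hSprop z hz
      exact hrim z (hSf hz) (by rw [hz0]; exact hx6) (by rw [hz0]; exact hzlo)
        (by rw [hz0]; exact hzhi.trans hhi) x hx1 hx2 hhx)
    (by
      obtain ⟨hz0, -, -⟩ := hSprop z₀ hz₀S
      obtain ⟨x, hx1, hx2, hhx⟩ := hseed z₀ (hSf hz₀S) (by rw [hz0]; exact hx6) (by rw [hz0]; exact hz₀r)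
      exact ⟨z₀, hz₀S, x, hx1, hx2, hhx⟩)
  obtain ⟨x, hx1, hx2, hhx⟩ := hentry y hyS
  -- conclusion
  have hyflat := hflat y rfl hr₀y le_rfl
  refine ⟨hyflat.1, hyflat.2.1, fun j ↦ ?_, x, lt_trans hτ' hx1, hadm x hx1.le hx2.le, hhx,
    hloc y hyflat.1 hx6 hlo hhi x hx1 hx2 hhx⟩
  rcases eq_or_ne j i with rfl | hij
  · linarith
  · exact hyflat.2.2 j hij

end AnchoredV2

end Summit.FinalStateConjecture.FinalStateConjecture.Theorems.GapDecaySuffices.Location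

end
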